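import Mathlib.Algebra.Group.Action.Sum
import Mathlib.Algebra.Group.Action.Sigma
import Literature.RepresentationTheory.FiniteGroups.PermutationLatticeReduction
import HarnessLib

/-!
# Reduction mod `p` along a short exact sequence of lattices, and the orbit decomposition of
# permutation lattices (Serre, *Linear Representations of Finite Groups*, §15.2; Milne, *ADT* I §2)

Topic `RepresentationTheory/FiniteGroups`; namespace `Literature.RepresentationTheory.FiniteGroups`
(sub-namespace `PermutationLattice`).  THEOREMS ONLY (no definition, no named fact, no `sorry`, no
instance).  Sequel of `PermutationLatticeReduction`; bookkeeping used to read Artin's twisted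
identity (`ArtinPermutationReductionTwist.twist_reduction_artinSets_eq`) orbit by orbit:

* §1 `additive_reduction_eq_add_of_shortExact` — for an invariant `ψ` additive on short exact
  sequences with finite `p`-torsion middle term and a short exact sequence of `ℤ[G]`-modules
  `0 → Λ₁ → Λ₂ → Λ₃ → 0` with `Λ₃` WITHOUT `p`-TORSION (so that it stays exact mod `p`:
  `Tor₁(Λ₃, ℤ/p) = Λ₃[p] = 0`) and `Λ₂/pΛ₂` finite: `ψ (Λ₂/p) = ψ (Λ₁/p) + ψ (Λ₃/p)`;
* §2 `additive_reduction_ofMulAction_sum` — `ψ (ℤ[X ⊔ Y]/p) = ψ (ℤ[X]/p) + ψ (ℤ[Y]/p)` for finite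
  `G`-sets (the split sequence `0 → ℤ[X] → ℤ[X ⊔ Y] → ℤ[Y] → 0`, `MonoidAlgebra.mapDomain Sum.inl`
  and `MonoidAlgebra.comapDomain Sum.inr`).

Road memo `TATE-EPC-TC-ROAD` (evidence #54 on stmt-BirchSwinnertonDyer-19032), brick B3b-4 (part 1).

## References
* J.-P. Serre, *Linear Representations of Finite Groups*, GTM 42 (1977), §15.2. [SerreLinearRepresentations1977]
* J. S. Milne, *Arithmetic Duality Theorems*, 2nd ed. (2006), I Lemma 2.10, Lemma 2.12. [MilneADT2006]
-/

namespace Literature.RepresentationTheory.FiniteGroups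

namespace PermutationLattice

open Function LinearMap Submodule MonoidAlgebra StableLatticeReduction
open scoped Pointwise MonoidAlgebra

variable {G : Type} [Group G] {A : Type*} [AddCommGroup A] {p : ℕ}

section SES

variable (ψ : ∀ ⦃Y : Type⦄ [AddCommGroup Y] [Module ℤ Y], Representation ℤ G Y → A)
  (hψ : ∀ ⦃X Y Z : Type⦄ [AddCommGroup X] [Module ℤ X] [AddCommGroup Y] [Module ℤ Y]
    [AddCommGroup Z] [Module ℤ Z] (ρX : Representation ℤ G X) (ρY : Representation ℤ G Y)
    (ρZ : Representation ℤ G Z) (f : X →ₗ[ℤ] Y) (g : Y →ₗ[ℤ] Z),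
    (∀ s x, f (ρX s x) = ρY s (f x)) → (∀ s y, g (ρY s y) = ρZ s (g y)) →
    Injective f → Surjective g → LinearMap.range f = LinearMap.ker g → Finite Y →
    (∀ y : Y, (p : ℤ) • y = 0) → ψ ρY = ψ ρX + ψ ρZ)
include hψ

/-! ### §1. Reduction mod `p` of a short exact sequence with torsion-free cokernel -/

/-- **`ψ (Λ₂/p) = ψ (Λ₁/p) + ψ (Λ₃/p)`** for a short exact sequence `0 → Λ₁ → Λ₂ → Λ₃ → 0` of
`ℤ[G]`-modules with `Λ₃` free of `p`-torsion and `Λ₂/pΛ₂` finite: the reduced sequence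
`0 → Λ₁/p → Λ₂/p → Λ₃/p → 0` is again exact. [cite: SerreLinearRepresentations1977, §15.2]
[cite: MilneADT2006, I Lemma 2.12] -/
theorem additive_reduction_eq_add_of_shortExact {Λ₁ Λ₂ Λ₃ : Type} [AddCommGroup Λ₁]
    [AddCommGroup Λ₂] [AddCommGroup Λ₃] (ρ₁ : Representation ℤ G Λ₁) (ρ₂ : Representation ℤ G Λ₂)
    (ρ₃ : Representation ℤ G Λ₃) (i : Λ₁ →ₗ[ℤ] Λ₂) (π : Λ₂ →ₗ[ℤ] Λ₃)
    (hi : ∀ s x, i (ρ₁ s x) = ρ₂ s (i x)) (hπ : ∀ s y, π (ρ₂ s y) = ρ₃ s (π y))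
    (hinj : Injective i) (hsurj : Surjective π) (hex : LinearMap.range i = LinearMap.ker π)
    (htor₃ : ∀ z : Λ₃, (p : ℤ) • z = 0 → z = 0)
    [Finite (Λ₂ ⧸ ((p : ℤ) • ⊤ : Submodule ℤ Λ₂))] :
    ψ (ρ₂.quotient ((p : ℤ) • ⊤) (smul_top_le_comap ρ₂ (p : ℤ))) =
      ψ (ρ₁.quotient ((p : ℤ) • ⊤) (smul_top_le_comap ρ₁ (p : ℤ))) +
        ψ (ρ₃.quotient ((p : ℤ) • ⊤) (smul_top_le_comap ρ₃ (p : ℤ))) := by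
  have hmem : ∀ {X : Type} [AddCommGroup X] (x : X), x ∈ ((p : ℤ) • ⊤ : Submodule ℤ X) ↔
      ∃ y : X, (p : ℤ) • y = x := fun x => by
    rw [mem_smul_pointwise_iff_exists]
    exact ⟨fun ⟨y, _, h⟩ => ⟨y, h⟩, fun ⟨y, h⟩ => ⟨y, mem_top, h⟩⟩
  -- the reduced maps
  have hi₀ : ((p : ℤ) • ⊤ : Submodule ℤ Λ₁) ≤ ((p : ℤ) • ⊤ : Submodule ℤ Λ₂).comap i := by
    intro x hx; obtain ⟨y, rfl⟩ := (hmem x).1 hx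
    exact (hmem _).2 ⟨i y, by rw [map_smul]⟩
  have hπ₀ : ((p : ℤ) • ⊤ : Submodule ℤ Λ₂) ≤ ((p : ℤ) • ⊤ : Submodule ℤ Λ₃).comap π := by
    intro x hx; obtain ⟨y, rfl⟩ := (hmem x).1 hx
    exact (hmem _).2 ⟨π y, by rw [map_smul]⟩
  set ib := mapQ _ _ i hi₀ with hibdef
  set πb := mapQ _ _ π hπ₀ with hπbdef
  refine hψ _ _ _ ib πb (fun s q => ?_) (fun s q => ?_) ?_ ?_ ?_ ‹_›
    (Int.smul_quotient_smul_top_eq_zero (p : ℤ))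
  · obtain ⟨x, rfl⟩ := mkQ_surjective _ q
    change (Submodule.Quotient.mk (i (ρ₁ s x)) : Λ₂ ⧸ ((p : ℤ) • ⊤ : Submodule ℤ Λ₂)) =
      Submodule.Quotient.mk (ρ₂ s (i x))
    rw [hi]
  · obtain ⟨y, rfl⟩ := mkQ_surjective _ q
    change (Submodule.Quotient.mk (π (ρ₂ s y)) : Λ₃ ⧸ ((p : ℤ) • ⊤ : Submodule ℤ Λ₃)) =
      Submodule.Quotient.mk (ρ₃ s (π y))
    rw [hπ]
  · -- injectivity mod `p` (uses `Λ₃` torsion-free)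
    rw [← LinearMap.ker_eq_bot, eq_bot_iff]
    intro q hq
    obtain ⟨x, rfl⟩ := mkQ_surjective _ q
    have hq' : (Submodule.Quotient.mk (i x) : Λ₂ ⧸ ((p : ℤ) • ⊤ : Submodule ℤ Λ₂)) = 0 := hq
    rw [Submodule.Quotient.mk_eq_zero, hmem] at hq'
    obtain ⟨y, hy⟩ := hq'
    have hπy : π y = 0 := by
      apply htor₃
      rw [← map_smul, hy, ← LinearMap.mem_ker, ← hex]
      exact ⟨x, rfl⟩
    obtain ⟨x', hx'⟩ : y ∈ LinearMap.range i := by rw [hex]; exact hπy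
    rw [mem_bot, mkQ_apply, Submodule.Quotient.mk_eq_zero, hmem]
    refine ⟨x', hinj ?_⟩
    rw [map_smul, hx', hy]
  · -- surjectivity mod `p`
    intro q
    obtain ⟨z, rfl⟩ := mkQ_surjective _ q
    obtain ⟨y, rfl⟩ := hsurj z
    exact ⟨Submodule.Quotient.mk y, rfl⟩
  · -- exactness mod `p`
    apply le_antisymm
    · rintro _ ⟨q, rfl⟩
      obtain ⟨x, rfl⟩ := mkQ_surjective _ q
      rw [LinearMap.mem_ker]
      change (Submodule.Quotient.mk (π (i x)) : Λ₃ ⧸ ((p : ℤ) • ⊤ : Submodule ℤ Λ₃)) = 0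
      have : π (i x) = 0 := by rw [← LinearMap.mem_ker, ← hex]; exact ⟨x, rfl⟩
      rw [this, Submodule.Quotient.mk_zero]
    · intro q hq
      obtain ⟨y, rfl⟩ := mkQ_surjective _ q
      have hq' : (Submodule.Quotient.mk (π y) : Λ₃ ⧸ ((p : ℤ) • ⊤ : Submodule ℤ Λ₃)) = 0 := hq
      rw [Submodule.Quotient.mk_eq_zero, hmem] at hq'
      obtain ⟨z, hz⟩ := hq'
      obtain ⟨y', rfl⟩ := hsurj z
      have hker : y - (p : ℤ) • y' ∈ LinearMap.ker π := by
        rw [LinearMap.mem_ker, map_sub, map_smul, hz, sub_self]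
      rw [← hex] at hker
      obtain ⟨x, hx⟩ := hker
      refine ⟨Submodule.Quotient.mk x, ?_⟩
      change (Submodule.Quotient.mk (i x) : Λ₂ ⧸ ((p : ℤ) • ⊤ : Submodule ℤ Λ₂)) = Submodule.Quotient.mk y
      rw [hx, Submodule.Quotient.eq, hmem]
      exact ⟨-y', by rw [smul_neg]; abel⟩

/-! ### §2. Disjoint union of `G`-sets -/

/-- **`ψ (ℤ[X ⊔ Y]/p) = ψ (ℤ[X]/p) + ψ (ℤ[Y]/p)`** for finite `G`-sets `X`, `Y` (the split sequence
`0 → ℤ[X] → ℤ[X ⊔ Y] → ℤ[Y] → 0`). [cite: SerreLinearRepresentations1977, §15.2]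
[cite: MilneADT2006, I Lemma 2.10] -/
theorem additive_reduction_ofMulAction_sum [hp : Fact p.Prime] (X Y : Type) [Fintype X] [Fintype Y]
    [MulAction G X] [MulAction G Y] :
    ψ ((Representation.ofMulAction ℤ G (X ⊕ Y)).quotient ((p : ℤ) • ⊤)
        (smul_top_le_comap _ (p : ℤ))) =
      ψ ((Representation.ofMulAction ℤ G X).quotient ((p : ℤ) • ⊤) (smul_top_le_comap _ (p : ℤ))) +
        ψ ((Representation.ofMulAction ℤ G Y).quotient ((p : ℤ) • ⊤)
          (smul_top_le_comap _ (p : ℤ))) := by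
  classical
  -- `i = mapDomain inl`, `π = comapDomain inr`
  let i₀ : MonoidAlgebra ℤ X →+ MonoidAlgebra ℤ (X ⊕ Y) :=
    { toFun := MonoidAlgebra.mapDomain Sum.inl
      map_zero' := MonoidAlgebra.mapDomain_zero _
      map_add' := MonoidAlgebra.mapDomain_add _ }
  let i : MonoidAlgebra ℤ X →ₗ[ℤ] MonoidAlgebra ℤ (X ⊕ Y) := i₀.toIntLinearMap
  let π : MonoidAlgebra ℤ (X ⊕ Y) →ₗ[ℤ] MonoidAlgebra ℤ Y :=
    (MonoidAlgebra.comapDomainAddMonoidHom Sum.inr Sum.inr_injective).toIntLinearMap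
  have hiv : ∀ x, i x = MonoidAlgebra.mapDomain Sum.inl x := fun _ => rfl
  have hπv : ∀ z, π z = MonoidAlgebra.comapDomain Sum.inr Sum.inr_injective z := fun _ => rfl
  haveI := finite_monoidAlgebra_quotient_smul_top (p := p) (X ⊕ Y)
  refine additive_reduction_eq_add_of_shortExact ψ hψ _ _ _ i π (fun s x => ?_) (fun s z => ?_)
    ?_ ?_ ?_ (smul_eq_zero_imp_monoidAlgebra (p := p) Y)
  · -- `i` equivariant
    rw [hiv, hiv]
    induction x using MonoidAlgebra.induction_linear with
    | zero => rw [map_zero, MonoidAlgebra.mapDomain_zero, map_zero]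
    | add x y hx hy =>
      rw [map_add, MonoidAlgebra.mapDomain_add, hx, hy, MonoidAlgebra.mapDomain_add, map_add]
    | single m r =>
      rw [Representation.ofMulAction_single, MonoidAlgebra.mapDomain_single,
        MonoidAlgebra.mapDomain_single, Representation.ofMulAction_single, Sum.smul_inl]
  · -- `π` equivariant
    rw [hπv, hπv]
    refine MonoidAlgebra.ext (Finsupp.ext fun y => ?_)
    rw [MonoidAlgebra.coeff_comapDomain, Finsupp.comapDomain_apply,
      Representation.coeff_ofMulAction, Representation.coeff_ofMulAction,
      MonoidAlgebra.coeff_comapDomain, Finsupp.comapDomain_apply, Sum.smul_inr]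
  · exact MonoidAlgebra.mapDomain_injective Sum.inl_injective
  · intro z
    refine ⟨MonoidAlgebra.mapDomain Sum.inr z, ?_⟩
    rw [hπv]
    induction z using MonoidAlgebra.induction_linear with
    | zero => rw [MonoidAlgebra.mapDomain_zero, MonoidAlgebra.comapDomain_zero]
    | add x y hx hy => rw [MonoidAlgebra.mapDomain_add, MonoidAlgebra.comapDomain_add, hx, hy]
    | single m r => rw [MonoidAlgebra.mapDomain_single, MonoidAlgebra.comapDomain_single_map]
  · -- `range i = ker π`
    apply le_antisymm
    · rintro _ ⟨x, rfl⟩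
      rw [LinearMap.mem_ker, hiv, hπv]
      induction x using MonoidAlgebra.induction_linear with
      | zero => rw [MonoidAlgebra.mapDomain_zero, MonoidAlgebra.comapDomain_zero]
      | add x y hx hy =>
        rw [MonoidAlgebra.mapDomain_add, MonoidAlgebra.comapDomain_add, hx, hy, add_zero]
      | single m r =>
        rw [MonoidAlgebra.mapDomain_single]
        exact MonoidAlgebra.comapDomain_single_of_not_mem_range (by simp) _
    · intro z hz
      rw [LinearMap.mem_ker, hπv] at hz
      -- `z` has no `inr`-coefficients, so it is `mapDomain inl (comapDomain inl z)`
      refine ⟨MonoidAlgebra.comapDomain Sum.inl Sum.inl_injective z, ?_⟩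
      rw [hiv]
      apply MonoidAlgebra.mapDomain_comapDomain
      intro w hw
      rcases w with x | y
      · exact ⟨x, rfl⟩
      · exfalso
        have h0 := congrArg (fun v => MonoidAlgebra.coeff v y) hz
        simp only [MonoidAlgebra.coeff_comapDomain, Finsupp.comapDomain_apply,
          MonoidAlgebra.coeff_zero, Finsupp.coe_zero, Pi.zero_apply] at h0
        exact (Finsupp.mem_support_iff.1 hw) h0

end SES

end PermutationLattice

end Literature.RepresentationTheory.FiniteGroups
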